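import Summits.ValiantsHypothesis.ValiantsHypothesis.Theorems.SymPencilHomogeneousDropTools

/-!
# Route `SymPencil` — the homogeneity drop for symmetric affine determinantal representations
# (core normal-form lemma; tool for the cruxes `SdcPerSq` stmt-ValiantsHypothesis-5675 and
# `SdcPerBeyondN` stmt-ValiantsHypothesis-5676)

Let `f = det (A₀ + M(z))` be a symmetric affine determinantal representation of size `m` of a
HOMOGENEOUS polynomial `f` of degree `n` over a field `k` of characteristic `0`, and let `x` be a
zero of `f` at which `Y := A(x)` has corank exactly `1`, kernel `k w`.  Homogeneity
(`f (c z) = c ^ n f (z)`) gives the identity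

  `det (Y + M(y) + ν A₀) = (1 + ν) ^ (m - n) · det (Y + M(y))`      (all `y`, all `ν ≠ -1`).

In a basis whose first vector is `w` one has `Y ≅ 0 ⊕ Δ` (`Δ` invertible symmetric),
`A₀ ≅ [[α, wᵀ], [w, E]]`, `M(y) ≅ [[a, bᵀ], [b, C]]`.  **This file proves**
(`eq_zero_of_det_add_smul`): if the "kernel-row map" `y ↦ (a(y), b(y))` is onto `k × k^{m-1}`,
then `m - n = 0` — the pencil cannot represent a homogeneous polynomial of degree `≠ m`.
Proof (Schur complements of the invertible `1 × 1` corner and first-order coefficients of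
one-variable polynomials only; tools in `SymPencilHomogeneousDropTools.lean`):
`α = 0` (else `ν ↦ det (Δ + ν N)` would vanish for all `ν ∉ {0, -1}` yet equal `det Δ ≠ 0` at
`0`); directions `(1, b)` at `ν = μ ε` give
`μ tr (Δ⁻¹ E) - 2 μ bᵀ Δ⁻¹ w - μ² wᵀ Δ⁻¹ w = (m - n) μ`, whence `w = 0`, `tr (Δ⁻¹ E) = m - n`; a
generic `ν₀` and the directions `(1, λ b)`, `λ ∈ {0, ±1}`, give `bᵀ ((Δ + ν₀ E)⁻¹ - Δ⁻¹) b = 0`,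
so `E = 0` and `m - n = tr (Δ⁻¹ E) = 0`.

The companion file `SymPencilHomogeneousHessianRank.lean` turns this into the rank bound
`rank Hess f (x) ≤ m` (one less than the symmetric Mignon–Ressayre bound `m + 1` of the route's
`HessianRankSymmDet`) for homogeneous `f` of degree `≠ m`, whence `sdc(per_n) ≥ n²` (`SdcPerSq`).
Not in the literature as far as searched (route file: GKKP 2011 §5, Landsberg 2017 Ch. 6,
arXiv:2606.11090 treat other bounds); elementary. [folklore]
-/

noncomputable section

-- single-conjunct layout: Sub = Summit, duplicated namespace component intended
set_option linter.dupNamespace false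

namespace Summit.ValiantsHypothesis.ValiantsHypothesis.Theorems.SymPencilHomogeneousDrop

open Matrix Polynomial
open Summit.ValiantsHypothesis.ValiantsHypothesis.Theorems.SymPencilHomogeneousDropTools

universe u

variable {k : Type u} [Field k]

/-! ### The core lemma -/

section Core

variable [CharZero k] {ι' : Type*} [Fintype ι'] [DecidableEq ι']
  {V : Type*} [AddCommGroup V] [Module k V]

/-- **Homogeneity drop, normal-form core.** Let `Δ` be invertible symmetric, `A₀ = [[α, wᵀ], [w, E]]`
symmetric, and `M` a linear family of symmetric matrices on `Unit ⊕ ι'` whose first-column map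
`v ↦ ((M v)₀₀, (M v)ᵢ₀)` is onto.  If
`det (0 ⊕ Δ + M v + ν A₀) = (1 + ν) ^ j · det (0 ⊕ Δ + M v)` for all `v` and all `ν ≠ -1`, then
`j = 0`.  (With `j = m - deg f` this says: a symmetric affine pencil with such a point represents
only homogeneous polynomials of degree `m`.) [folklore] -/
theorem eq_zero_of_det_add_smul (Δ E : Matrix ι' ι' k) (hΔ : IsUnit Δ.det) (hΔs : Δᵀ = Δ)
    (hEs : Eᵀ = E) (α : k) (w : ι' → k) (j : ℕ)
    (M : V →ₗ[k] Matrix (Unit ⊕ ι') (Unit ⊕ ι') k) (hMs : ∀ v, (M v)ᵀ = M v)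
    (hH : ∀ (v : V) (ν : k), ν ≠ -1 →
      (Matrix.fromBlocks (0 : Matrix Unit Unit k) 0 0 Δ + M v +
          ν • Matrix.fromBlocks (α • (1 : Matrix Unit Unit k)) (Matrix.replicateRow Unit w)
            (Matrix.replicateCol Unit w) E).det =
        (1 + ν) ^ j * (Matrix.fromBlocks (0 : Matrix Unit Unit k) 0 0 Δ + M v).det)
    (hS : ∀ (a : k) (b : ι' → k), ∃ v, M v (Sum.inl ()) (Sum.inl ()) = a ∧
      ∀ i, M v (Sum.inr i) (Sum.inl ()) = b i) :
    j = 0 := by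
  classical
  have hΔ0 : Δ.det ≠ 0 := hΔ.ne_zero
  have hΔis : (Δ⁻¹)ᵀ = Δ⁻¹ := by rw [Matrix.transpose_nonsing_inv, hΔs]
  -- the identity along a direction `v` with first column `(a, b)`, scaled by `ε`, at `ν`
  have hHdir : ∀ (v : V) (a : k) (b : ι' → k), M v (Sum.inl ()) (Sum.inl ()) = a →
      (∀ i, M v (Sum.inr i) (Sum.inl ()) = b i) → ∀ (ε ν : k), ν ≠ -1 →
      (Matrix.fromBlocks ((ε * a + ν * α) • (1 : Matrix Unit Unit k))
        (Matrix.replicateRow Unit (ε • b + ν • w)) (Matrix.replicateCol Unit (ε • b + ν • w))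
        (Δ + ε • (M v).toBlocks₂₂ + ν • E)).det =
      (1 + ν) ^ j * (Matrix.fromBlocks ((ε * a) • (1 : Matrix Unit Unit k))
        (Matrix.replicateRow Unit (ε • b)) (Matrix.replicateCol Unit (ε • b))
        (Δ + ε • (M v).toBlocks₂₂)).det := by
    intro v a b ha hb ε ν hν
    have h := hH (ε • v) ν hν
    rw [map_smul, eq_fromBlocks_of_col (hMs v) ha hb, fromBlocks_add_smul_add_smul,
      fromBlocks_add_smul] at h
    exact h
  -- Step 0: the corner `α` of `A₀` vanishes
  have hα : α = 0 := by
    by_contra hα0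
    obtain ⟨v₀, h0a, h0b⟩ := hS 0 0
    set N : Matrix ι' ι' k := E - α⁻¹ • Matrix.vecMulVec w w with hN
    have hdet : ∀ ν : k, ν ∉ ({0, -1} : Finset k) → (Δ + ν • N).det = 0 := by
      intro ν hν
      simp only [Finset.mem_insert, Finset.mem_singleton, not_or] at hν
      have h := hHdir v₀ 0 0 h0a h0b 0 ν hν.2
      simp only [mul_zero, zero_add, zero_smul, add_zero] at h
      have hD : (Matrix.fromBlocks (0 : Matrix Unit Unit k)
          (Matrix.replicateRow Unit (0 : ι' → k)) (Matrix.replicateCol Unit (0 : ι' → k)) Δ).det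
          = 0 :=
        Matrix.det_eq_zero_of_row_eq_zero (Sum.inl ()) fun j => by cases j <;> simp
      rw [hD, mul_zero, det_fromBlocks_corner (mul_ne_zero hν.1 hα0)] at h
      have h' := (mul_eq_zero.1 h).resolve_left (mul_ne_zero hν.1 hα0)
      have hmat : Δ + ν • E - (ν * α)⁻¹ • Matrix.vecMulVec (ν • w) (ν • w) = Δ + ν • N := by
        have hs : (ν * α)⁻¹ * ν * ν = ν * α⁻¹ := by
          field_simp [hν.1, hα0]
        rw [hN, Matrix.smul_vecMulVec, Matrix.vecMulVec_smul, smul_smul, smul_smul, hs, smul_sub,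
          smul_smul, add_sub_assoc]
      rwa [hmat] at h'
    have hp : (Δ.map Polynomial.C + (Polynomial.X : k[X]) • N.map Polynomial.C).det = 0 := by
      apply Polynomial.eq_zero_of_infinite_isRoot
      refine Set.Infinite.mono (s := {ν : k | ν ∉ ({0, -1} : Finset k)}) (fun ν hν => ?_)
        (Finset.finite_toSet _).infinite_compl
      simp only [Set.mem_setOf_eq] at hν ⊢
      rw [Polynomial.IsRoot.def, eval_detLine]
      exact hdet ν hν
    have h0 := coeff_detLine_zero Δ N
    rw [hp, Polynomial.coeff_zero] at h0
    exact hΔ0 h0.symm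
  -- Step 1: directions `(1, b)` at `ν = μ ε`
  have hS1 : ∀ (b : ι' → k) (μ : k),
      μ * (Δ⁻¹ * E).trace - μ * ((Δ⁻¹ *ᵥ b) ⬝ᵥ w + (Δ⁻¹ *ᵥ w) ⬝ᵥ b) -
        μ ^ 2 * ((Δ⁻¹ *ᵥ w) ⬝ᵥ w) = j * μ := by
    intro b μ
    obtain ⟨v, hva, hvb⟩ := hS 1 b
    set C : Matrix ι' ι' k := (M v).toBlocks₂₂ with hC
    set N₁ : Matrix ι' ι' k := C + μ • E - Matrix.vecMulVec (b + μ • w) (b + μ • w) with hN₁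
    set N₂ : Matrix ι' ι' k := C - Matrix.vecMulVec b b with hN₂
    have key : ∀ ε : k, ε ∉ ({0, -μ⁻¹} : Finset k) →
        (Δ + ε • N₁).det = 1 * (1 + μ * ε) ^ j * (Δ + ε • N₂).det := by
      intro ε hε
      simp only [Finset.mem_insert, Finset.mem_singleton, not_or] at hε
      have hε0 : ε ≠ 0 := hε.1
      have hε1 : μ * ε ≠ -1 := by
        intro h
        apply hε.2
        have hμ : μ ≠ 0 := by rintro rfl; simp at h
        field_simp
        linear_combination h
      have h := hHdir v 1 b hva hvb ε (μ * ε) hε1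
      rw [hα, mul_zero, add_zero, mul_one, det_fromBlocks_corner hε0,
        det_fromBlocks_corner hε0] at h
      have hm1 : Δ + ε • C + (μ * ε) • E - ε⁻¹ • Matrix.vecMulVec (ε • b + (μ * ε) • w)
          (ε • b + (μ * ε) • w) = Δ + ε • N₁ := by
        have hu : ε • b + (μ * ε) • w = ε • (b + μ • w) := by
          rw [smul_add, smul_smul, mul_comm μ ε]
        rw [hu, inv_smul_vecMulVec_smul hε0, hN₁, smul_sub, smul_add, smul_smul, mul_comm ε μ]
        abel
      have hm2 : Δ + ε • C - ε⁻¹ • Matrix.vecMulVec (ε • b) (ε • b) = Δ + ε • N₂ := by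
        rw [inv_smul_vecMulVec_smul hε0, hN₂, smul_sub]
        abel
      rw [hm1, hm2, ← mul_assoc, mul_comm ((1 + μ * ε) ^ j) ε, mul_assoc] at h
      rw [one_mul]
      exact mul_left_cancel₀ hε0 h
    obtain ⟨-, h1⟩ := coeff_eq_of_det_add_smul_eq _ key
    rw [coeff_detLine_one hΔ, coeff_detLine_one hΔ, one_mul] at h1
    have h2 : (Δ⁻¹ * N₁).trace = j * μ + (Δ⁻¹ * N₂).trace :=
      mul_left_cancel₀ hΔ0 (by rw [h1]; ring)
    simp only [hN₁, hN₂, Matrix.mul_add, Matrix.mul_sub, Matrix.mul_smul, Matrix.trace_add,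
      Matrix.trace_sub, Matrix.trace_smul, trace_mul_vecMulVec, Matrix.mulVec_add,
      Matrix.mulVec_smul, dotProduct_add, add_dotProduct, dotProduct_smul, smul_dotProduct,
      smul_eq_mul] at h2
    linear_combination h2
  -- consequences: `wᵀ Δ⁻¹ w = 0`, `tr (Δ⁻¹ E) = j`, `w = 0`
  have hsw : (Δ⁻¹ *ᵥ w) ⬝ᵥ w = 0 := by
    have h1 := hS1 0 1
    have h2 := hS1 0 (-1)
    simp only [Matrix.mulVec_zero, zero_dotProduct, dotProduct_zero, add_zero] at h1 h2
    have h3 : (2 : k) * ((Δ⁻¹ *ᵥ w) ⬝ᵥ w) = 0 := by linear_combination -(h1 + h2)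
    exact (mul_eq_zero.1 h3).resolve_left two_ne_zero
  have ht : (Δ⁻¹ * E).trace = j := by
    have h1 := hS1 0 1
    simp only [Matrix.mulVec_zero, zero_dotProduct, dotProduct_zero, add_zero, hsw] at h1
    linear_combination h1
  have hw : w = 0 := by
    have hΔw : Δ⁻¹ *ᵥ w = 0 := by
      ext i
      have h1 := hS1 (Pi.single i 1) 1
      rw [ht, hsw] at h1
      have hsym : (Δ⁻¹ *ᵥ Pi.single i 1) ⬝ᵥ w = (Δ⁻¹ *ᵥ w) ⬝ᵥ Pi.single i 1 := by
        rw [dotProduct_comm, Matrix.dotProduct_mulVec, ← Matrix.mulVec_transpose, hΔis]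
      rw [hsym, dotProduct_single_one] at h1
      have h3 : (2 : k) * (Δ⁻¹ *ᵥ w) i = 0 := by linear_combination -h1
      rw [Pi.zero_apply]
      exact (mul_eq_zero.1 h3).resolve_left two_ne_zero
    have h := congr_arg (fun u => Δ *ᵥ u) hΔw
    simp only [Matrix.mulVec_mulVec, Matrix.mul_nonsing_inv _ hΔ, Matrix.one_mulVec,
      Matrix.mulVec_zero] at h
    exact h
  -- Step 2: a generic `ν₀` and directions `(1, λ b)`
  have hq0 : (Δ.map Polynomial.C + (Polynomial.X : k[X]) • E.map Polynomial.C).det ≠ 0 := by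
    intro h
    have h0 := coeff_detLine_zero Δ E
    rw [h, Polynomial.coeff_zero] at h0
    exact hΔ0 h0.symm
  obtain ⟨ν₀, hν₀⟩ := Infinite.exists_notMem_finset
    ((Δ.map Polynomial.C + (Polynomial.X : k[X]) • E.map Polynomial.C).det.roots.toFinset ∪
      {0, -1})
  simp only [Finset.mem_union, Multiset.mem_toFinset, Polynomial.mem_roots hq0,
    Polynomial.IsRoot.def, eval_detLine, Finset.mem_insert, Finset.mem_singleton, not_or] at hν₀
  obtain ⟨hΔ'0, hν00, hν01⟩ := hν₀
  set Δ' : Matrix ι' ι' k := Δ + ν₀ • E with hΔ'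
  have hΔ'u : IsUnit Δ'.det := isUnit_iff_ne_zero.2 hΔ'0
  have hc : ((1 + ν₀) ^ j : k) ≠ 0 := by
    refine pow_ne_zero _ fun h => hν01 ?_
    linear_combination h
  have hS2 : ∀ (v : V) (b : ι' → k), M v (Sum.inl ()) (Sum.inl ()) = 1 →
      (∀ i, M v (Sum.inr i) (Sum.inl ()) = b i) →
      ((Δ'⁻¹ - Δ⁻¹) * ((M v).toBlocks₂₂ - Matrix.vecMulVec b b)).trace = 0 := by
    intro v b hva hvb
    set C : Matrix ι' ι' k := (M v).toBlocks₂₂ with hC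
    set N₂ : Matrix ι' ι' k := C - Matrix.vecMulVec b b with hN₂
    have key : ∀ ε : k, ε ∉ ({0} : Finset k) →
        (Δ' + ε • N₂).det = (1 + ν₀) ^ j * (1 + 0 * ε) ^ j * (Δ + ε • N₂).det := by
      intro ε hε
      simp only [Finset.mem_singleton] at hε
      have h := hHdir v 1 b hva hvb ε ν₀ hν01
      rw [hα, hw, mul_zero, add_zero, mul_one, smul_zero, add_zero, det_fromBlocks_corner hε,
        det_fromBlocks_corner hε, inv_smul_vecMulVec_smul hε] at h
      have hm1 : Δ + ε • C + ν₀ • E - ε • Matrix.vecMulVec b b = Δ' + ε • N₂ := by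
        rw [hΔ', hN₂, smul_sub]; abel
      have hm2 : Δ + ε • C - ε • Matrix.vecMulVec b b = Δ + ε • N₂ := by
        rw [hN₂, smul_sub]; abel
      rw [hm1, hm2, ← mul_assoc, mul_comm ((1 + ν₀) ^ j) ε, mul_assoc] at h
      rw [zero_mul, add_zero, one_pow, mul_one]
      exact mul_left_cancel₀ hε h
    obtain ⟨h0, h1⟩ := coeff_eq_of_det_add_smul_eq _ key
    rw [coeff_detLine_one hΔ'u, coeff_detLine_one hΔ, mul_zero, zero_mul, zero_add,
      ← mul_assoc, ← h0] at h1
    have h2 : (Δ'⁻¹ * N₂).trace = (Δ⁻¹ * N₂).trace := mul_left_cancel₀ hΔ'0 h1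
    rw [Matrix.sub_mul, Matrix.trace_sub, h2, sub_self]
  have hquad : ∀ b : ι' → k, b ⬝ᵥ (Δ'⁻¹ - Δ⁻¹) *ᵥ b = 0 := by
    intro b
    obtain ⟨v₁, h1a, h1b⟩ := hS 1 0
    obtain ⟨u, hua, hub⟩ := hS 0 b
    have g : ∀ c : k, ((Δ'⁻¹ - Δ⁻¹) * ((M v₁).toBlocks₂₂ + c • (M u).toBlocks₂₂ -
        c ^ 2 • Matrix.vecMulVec b b)).trace = 0 := by
      intro c
      have h := hS2 (v₁ + c • u) (c • b) (by simp [h1a, hua]) (fun i => by simp [h1b, hub])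
      have hT : (M (v₁ + c • u)).toBlocks₂₂ = (M v₁).toBlocks₂₂ + c • (M u).toBlocks₂₂ := by
        ext i j
        simp [Matrix.toBlocks₂₂]
      rwa [hT, Matrix.smul_vecMulVec, Matrix.vecMulVec_smul, smul_smul, ← pow_two] at h
    have g0 := g 0
    have g1 := g 1
    have g2 := g (-1)
    simp only [Matrix.mul_add, Matrix.mul_sub, Matrix.mul_smul, Matrix.trace_add,
      Matrix.trace_sub, Matrix.trace_smul, trace_mul_vecMulVec, smul_eq_mul] at g0 g1 g2
    have h3 : (2 : k) * ((Δ'⁻¹ - Δ⁻¹) *ᵥ b ⬝ᵥ b) = 0 := by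
      linear_combination 2 * g0 - g1 - g2
    rw [dotProduct_comm]
    exact (mul_eq_zero.1 h3).resolve_left two_ne_zero
  have hNd : Δ'⁻¹ - Δ⁻¹ = 0 := by
    refine eq_zero_of_quadratic_form_eq_zero ?_ hquad
    have hΔ's : Δ'ᵀ = Δ' := by rw [hΔ', Matrix.transpose_add, Matrix.transpose_smul, hΔs, hEs]
    rw [Matrix.transpose_sub, Matrix.transpose_nonsing_inv, Matrix.transpose_nonsing_inv, hΔ's,
      hΔs]
  have hE : E = 0 := by
    have h1 : Δ'⁻¹ = Δ⁻¹ := sub_eq_zero.1 hNd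
    have h2 : Δ' = Δ := by
      rw [← Matrix.nonsing_inv_nonsing_inv Δ' hΔ'u, h1, Matrix.nonsing_inv_nonsing_inv Δ hΔ]
    have h3 : ν₀ • E = 0 := by
      have := congr_arg (fun X => X - Δ) h2
      simpa [hΔ'] using this
    exact (smul_eq_zero.1 h3).resolve_left hν00
  -- Step 3
  rw [hE, Matrix.mul_zero, Matrix.trace_zero] at ht
  exact_mod_cast ht.symm

end Core

end Summit.ValiantsHypothesis.ValiantsHypothesis.Theorems.SymPencilHomogeneousDrop

end
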